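import Literature.MathematicalPhysics.QuantumFieldTheory.Balaban1983to89.Beta.TwoPowerLegs

/-!
# `Balaban1983to89.Beta.BlockLegs` — BLOCK AVERAGES of a two-power family are a two-power family, constants FREE of the
blocking scale: the position-space route to the `k ≥ 1` legs (β sub-cell, row BETA-an3 gen 5, node BETA-an3-g5-LEGS;
BETA-SPEC v1.9g §6.12 OWNERS (vi), RULING (R7) «C_k, not Γ_k»; companion of `Beta.TwoPowerLegs`)

HONEST FRAMING (cell rule, verbatim): discharging `BetaPertH` makes Bałaban's UV stability UNCONDITIONAL — a real
constructive-QFT result; it is NOT the continuum limit and NOT the Clay problem.  (Gloss, BETA-SPEC v1.8d/v1.9b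
l. 17–18, GAPS G-ref2-14 (a) / G-ref2-20 (a), verbatim: «UNCONDITIONAL» in [Balaban1989LargeFieldII] (B16) p. 355's
interval-hypothesis sense ONLY (`FlowStepRuns.p355Unconditional_of_partialSums` keeps `hnodes`); the located leaves
G-adv3-2 (left inequality of (0.1)/(2.50), d = 4), G-adv3-1 (U2 transfer of B14 Cor. 3's lower bound) and `SecondExpLeaf`
REMAIN.  Gloss 2, BETA-SPEC v1.9e, beta-ref C-beta-78, BINDING: «unconditional» = `Beta.Assembly.EventualForm`-unconditional END
statement, NOT «Theorem 2 as printed».)  THIS MODULE DISCHARGES NOTHING of the series and asserts nothing about Bałaban's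
propagators, kernels or β-functions: every statement below is about an ARBITRARY `TwoPowerLegs.TwoPower` family `g` and
ARBITRARY block data (scale `n`, offsets `S`, weights `ω`).  Every declaration is `[folklore]`.  Value = kernel certificate
(audit cell `pub-balaban`, β sub-cell, unit `b2b-balaban-beta-an3-g5`), NOT summit progress.

WHAT THIS MODULE IS.  The (W1) legs for `k ≥ 1` are, per RULING (R7), entries of an `(L,k)`-indexed UNIT-lattice covariance
whose unit-lattice symbol is an ALIAS SUM over a fine lattice of spacing `1/n` ([Balaban1984PropagatorsI] (INDEX B5)
(1.61)–(1.62) p. 28, CONTEXT ONLY) — in position space: a DOUBLE BLOCK AVERAGE `Σ_{m,m′∈S} ω(m)ω(m′)·n²·g(n·x + m − m′)` of a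
fine-lattice family `g` over block offsets `‖m‖∞ ≤ ρn` with normalised weights (`Σω = 1`, `Σ|ω| ≤ Ω`, `|ω| ≤ Ω∞/n⁴`).  The
momentum route to its asymptotics meets the non-analyticity of the alias sum at `p′ = 0` (an1-g3, `B4Strip.DeltaXi_poleWitness`:
homogeneous of degree 0, `C^{1,1}` not `C²`); the POSITION route needs only `TwoPowerLegs.taylor2_invSq` and the shell counting
of `TransferUV`:
* (F1) FAR FIELD `‖x‖∞ ≥ 4ρ+1` (`block_far`): expand `n²c₄/|nx + ζ|₂²` (`ζ = m − m′`, `‖ζ‖∞ ≤ 2ρn ≤ ‖nx‖∞/2`) to second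
  order: the zeroth order is `c₄/|x|₂²` EXACTLY (scaling `n²/|nx|² = 1/|x|²`), the FIRST order `c₄ζ·∇|·|⁻²(x)/n` CANCELS in
  the double average (`Σ_{m,m′} ω(m)ω(m′)(φ(m) − φ(m′)) = 0`, no symmetry of `ω` needed), the second-order remainder is
  `≤ 448c₄ρ²/‖x‖∞⁴` and the fine family's own two-power error contributes `n²·B/‖nx/2‖∞⁴ ≤ 16B/‖x‖∞⁴` — all FREE OF `n`;
* (F2) NEAR FIELD `‖x‖∞ ≤ 4ρ` (`block_near`): the flat weights `|ω| ≤ Ω∞/n⁴` against the lattice sum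
  `Σ_{‖u‖∞ ≤ 6ρn} |g(u)| ≤ U + 80(c₄ + B)(6ρn)²` (shellwise, `#shell ≤ 80(r+1)³`, `|g(u)| ≤ (c₄+B)/‖u‖∞²`) give
  `|C(x)| ≤ ΩΩ∞(U + 2880(c₄ + B)ρ²)`, FREE OF `n`;
* `block` (§4): the block-averaged family IS a `TwoPower` family with the explicit constants
  `B_C = Ω²(16B + 448c₄ρ²) + (ΩΩ∞(U + 2880(c₄+B)ρ²) + c₄)(4ρ+1)⁴`, `U_C = ΩΩ∞(U + 2880(c₄+B)ρ²) + c₄ + Ω²(16B + 448c₄ρ²)`,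
  hence (TwoPowerLegs §2) its undifferentiated and gradient legs are `Leg`s with `(L,k)`-free constants and the wall
  follows from (W2), (W3), window comparability and any two-derivative leg (`stepBal_le_of_block`);
* (F3) SHARP DIFFERENCES SURVIVE BLOCKING (§6–§7, `block_sharp_far`, `block_sharpDiff`): if the fine family has sharp
  differences (`TwoPowerLegs.SharpDiff T B₃`), so has the block family, with the `(L,k)`-free constant `B3block`.  The
  move: `C(x + e_i) − C(x)` is a double average of `n²(g(v + ne_i) − g(v))`, `v = nx + ζ`; the fine family's part
  telescopes over `n` unit steps all at distance `≥ n‖x‖∞/2` (`sharp_telescope`: `n·n²·B₃/(n‖x‖∞/2)⁵ ≤ 32B₃/‖x‖∞⁵`), and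
  BOTH continuum values `n²c₄/|nx + ζ + ne_i|₂²`, `n²c₄/|nx + ζ|₂²` are expanded to THIRD order at the SAME base point
  `nx` (`TwoPowerLegs.taylor3_invSq`, remainders `3712c₄((2ρ+1)³ + 8ρ³)/‖x‖∞⁵`): the polynomial parts differ by
  `c₄(∂_i + ∂_i²/2)|x|⁻²` EXACTLY (scaling) plus a `ζ`-LINEAR cross term, which cancels in the double average — so no
  derivative of the Hessian is ever needed; the unit-scale increment `c₄(|x+e_i|⁻² − |x|⁻²)` is `c₄(∂_i + ∂_i²/2)|x|⁻²` up to
  `3712c₄/‖x‖∞⁵` by the same expansion (`pair_sharp`);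
* `stepBal_le_of_blockSharp` (§7): the wall with ALL FOUR legs the block family's own (`baseLeg`, `fwdLeg μ`, `mixedLeg`,
  `fwdLeg ν` of TwoPowerLegs), from block data + (F1)(F2)(F3) of the fine family + (W2)/(W3)/window comparability;
* §8, KERNEL: at `g = latticeGreen/2` (`TwoPowerLegs.free`, (F3) from lit1 v1.1 via `TwoPowerLegs.free_sharp`) —
  `freeBlock D`, `freeBlock_sharp`, `freeBlockMixedLeg`, `stepBal_le_of_freeBlockSharp`: the block-averaged MASSLESS
  fine-lattice covariance, for EVERY blocking scale `n = n(L,k)` (e.g. `L^k`) and every normalised flat block weight, has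
  all four (W1)-type legs with `(L,k)`-FREE constants, UNCONDITIONALLY.  This is the `U = 1` reading of (R7)'s `C_k` up
  to its local (`x = 0`) term, which (F1)/(F3) never see in the far field and (F2) absorbs; WHETHER Bałaban's `C_k` is this
  object (plus which local term, which weights `ω`) is the carrier's business (row an5's successor per §6.12 OWNERS;
  dictionary an2 (iii)), NOT asserted here.

WHAT THIS MODULE DOES NOT DO.  No claim about Bałaban's operators, kernels or β-functions; no Woodbury/`Γ_k` term ((W2),
RULING (R7)); no (W2)/(W3) input (`hin`, `hout` stay hypotheses: rows an2 / an4 / ref); no identification of the (W1)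
legs of [Balaban1989LargeFieldI] (1.20)–(1.24) with block averages (carrier / dictionary).

CITATION HEADER (cell ABSOLUTE RULE: the manuscripts under audit are context, never authority).
* [Balaban1984PropagatorsI] T. Bałaban, Propagators and renormalization transformations for lattice gauge theories. I,
  Comm. Math. Phys. 95 (1984) 17–40 (INDEX B5) — (1.61)–(1.62) p. 28.  CONTEXT ONLY.  [Balaban1989LargeFieldI] T. Bałaban,
  Large field renormalization. I, Comm. Math. Phys. 122 (1989) 175–202 — (1.20)–(1.24) pp. 8–9.  CONTEXT ONLY.
* Internal division of labour (NOT citations): BETA-SPEC.md v1.9g §6.12 / §7.12 (R7); AN3.md v5 §10; an1-g3 CLAIM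
  2026-08-18T23:10:45Z (non-analyticity at `p′ = 0`).

Tags: [folklore] = elementary real analysis / algebra proved here, or a structure/definition asserting nothing.
No `axiom`, no `sorry`; every theorem's hypotheses are explicit binders.
-/

noncomputable section

namespace Literature.MathematicalPhysics.QuantumFieldTheory.Balaban1983to89.Beta.BlockLegs

open Finset
open Literature.Probability.LatticeModels (annulus box latticeGreen)
open Literature.MathematicalPhysics.QuantumFieldTheory.Balaban1983to89
open Literature.MathematicalPhysics.QuantumFieldTheory.Balaban1983to89.Beta
open Literature.MathematicalPhysics.QuantumFieldTheory.Balaban1983to89.Beta.TransverseStructure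
open Literature.MathematicalPhysics.QuantumFieldTheory.Balaban1983to89.Beta.TransverseLink
open Literature.MathematicalPhysics.QuantumFieldTheory.Balaban1983to89.Beta.LeadingCoefficient
open Literature.MathematicalPhysics.QuantumFieldTheory.Balaban1983to89.Beta.DyadicShell
open Literature.MathematicalPhysics.QuantumFieldTheory.Balaban1983to89.Beta.TransferUV
  (card_annulus_succ_four_le abs_sum_annulus_zero_le)
open Literature.MathematicalPhysics.QuantumFieldTheory.Balaban1983to89.Beta.LargeLWindow (WindowDecomposition)
open Literature.MathematicalPhysics.QuantumFieldTheory.Balaban1983to89.Beta.BubbleTransfer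
open Literature.MathematicalPhysics.QuantumFieldTheory.Balaban1983to89.Beta.WindowInterface
open Literature.MathematicalPhysics.QuantumFieldTheory.Balaban1983to89.Beta.TwoPowerLegs
open Literature.MathematicalPhysics.QuantumFieldTheory.GawedzkiKupiainen1985 (toReal_sub)

/-! ## §1. Scaling of the continuum legs and of the embedding `ℤ⁴ → ℝ⁴` -/

/-- `toReal (n • x) = n • toReal x`. [folklore] -/
theorem toReal_nsmul (n : ℕ) (x : Pt) : toReal (n • x) = (n : ℝ) • toReal x := by
  ext i; simp [toReal]

/-- `1/|tX|₂² = (1/|X|₂²)/t²` (both sides `0` at `t = 0`). [folklore] -/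
theorem invSq_smul (t : ℝ) (X : E4) : invSq (t • X) = invSq X / t ^ 2 := by
  rw [invSq, invSq, r2_smul, div_div, mul_comm]

/-- `∂_μ|tX|⁻² = ∂_μ|X|⁻²/t³` (`t ≠ 0`). [folklore] -/
theorem d1InvSq_smul {t : ℝ} (ht : t ≠ 0) (μ : Fin 4) (X : E4) : d1InvSq μ (t • X) = d1InvSq μ X / t ^ 3 := by
  simp only [d1InvSq, r2_smul, Pi.smul_apply, smul_eq_mul]
  by_cases hR : r2 X = 0
  · simp [hR]
  · rw [div_div, div_eq_div_iff (pow_ne_zero 2 (mul_ne_zero (pow_ne_zero 2 ht) hR))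
      (mul_ne_zero (pow_ne_zero 2 hR) (pow_ne_zero 3 ht))]
    ring

/-- `‖n • X‖∞ = n‖X‖∞`. [folklore] -/
theorem norm_natCast_smul (n : ℕ) (X : E4) : ‖(n : ℝ) • X‖ = n * ‖X‖ := by
  rw [norm_smul, Real.norm_eq_abs, abs_of_nonneg (Nat.cast_nonneg n)]

/-- Sup-norm triangle inequality on `ℤ⁴` (real form). [folklore] -/
theorem supNorm_add_le_real (a b : Pt) : (supNorm (a + b) : ℝ) ≤ supNorm a + supNorm b := by
  rw [← norm_toReal, ← norm_toReal, ← norm_toReal, toReal_add]; exact norm_add_le _ _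

/-- `‖a − b‖∞ ≤ ‖a‖∞ + ‖b‖∞` (real form). [folklore] -/
theorem supNorm_sub_le_real (a b : Pt) : (supNorm (a - b) : ℝ) ≤ supNorm a + supNorm b := by
  rw [← norm_toReal, ← norm_toReal, ← norm_toReal, toReal_sub]; exact norm_sub_le _ _

/-- `‖n • x‖∞ = n‖x‖∞` (real form). [folklore] -/
theorem supNorm_nsmul_real (n : ℕ) (x : Pt) : (supNorm (n • x) : ℝ) = n * supNorm x := by
  rw [← norm_toReal, ← norm_toReal, toReal_nsmul, norm_natCast_smul]

/-! ## §2. (F1) FAR FIELD: the double block average of `n²g(nx + m − m′)` is `c₄/|x|₂²` up to `O(‖x‖∞⁻⁴)` free of `n` -/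

section Far

variable (T : TwoPower)

/-- **ONE PAIR, FAR FIELD**: for `1 ≤ n`, `‖m‖∞, ‖m′‖∞ ≤ ρn`, `‖x‖∞ ≥ 4ρ + 1`,
`|n²g(nx + m − m′) − c₄/|x|₂² − c₄(m − m′)·∇|x|⁻²/n| ≤ (16B + 448c₄ρ²)/‖x‖∞⁴` — zeroth order exact by scaling, first
order kept (it cancels only after averaging), second order and the family's two-power error free of `n`. [folklore] -/
theorem pair_far (L k : ℕ) {n ρ : ℕ} (hn : 1 ≤ n) {x m m' : Pt} (hm : supNorm m ≤ ρ * n) (hm' : supNorm m' ≤ ρ * n)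
    (hx : 4 * ρ + 1 ≤ supNorm x) :
    |(n : ℝ) ^ 2 * T.g L k (n • x + m - m') - c4 * invSq (toReal x) -
        c4 * (∑ μ, toReal (m - m') μ * d1InvSq μ (toReal x)) / n| ≤
      (16 * T.B + 448 * c4 * (ρ : ℝ) ^ 2) / (supNorm x : ℝ) ^ 4 := by
  set X : E4 := toReal x with hX
  set ζ : E4 := toReal (m - m') with hζ
  set Y : E4 := (n : ℝ) • X with hY
  have hn' : (1 : ℝ) ≤ n := by exact_mod_cast hn
  have hn0 : (n : ℝ) ≠ 0 := by positivity
  have hs : 4 * (ρ : ℝ) + 1 ≤ supNorm x := by exact_mod_cast hx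
  have hρ0 : (0 : ℝ) ≤ ρ := Nat.cast_nonneg ρ
  have hs1 : (1 : ℝ) ≤ supNorm x := by linarith
  have hsX : ‖X‖ = supNorm x := norm_toReal x
  have hYn : ‖Y‖ = n * supNorm x := by rw [hY, norm_natCast_smul, hsX]
  have hζle : ‖ζ‖ ≤ 2 * ρ * n := by
    have h1 : (supNorm m : ℝ) ≤ ρ * n := by exact_mod_cast hm
    have h2 : (supNorm m' : ℝ) ≤ ρ * n := by exact_mod_cast hm'
    rw [hζ, norm_toReal]
    have := supNorm_sub_le_real m m'
    linarith
  have h2ζ : 2 * ‖ζ‖ ≤ ‖Y‖ := by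
    rw [hYn]
    have : 4 * (ρ : ℝ) * n ≤ n * supNorm x := by nlinarith
    linarith
  have hYpos : 0 < ‖Y‖ := by rw [hYn]; positivity
  have hY0 : Y ≠ 0 := norm_pos_iff.mp hYpos
  have ev : toReal (n • x + m - m') = Y + ζ := by
    rw [toReal_sub, toReal_add, toReal_nsmul, hζ, toReal_sub, hY, hX, add_sub_assoc]
  have hYζ : ‖Y‖ / 2 ≤ ‖Y + ζ‖ := half_norm_le_norm_add h2ζ
  have hYζpos : 0 < ‖Y + ζ‖ := by linarith
  have hv0 : n • x + m - m' ≠ 0 := by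
    intro h
    have : toReal (n • x + m - m') = 0 := toReal_eq_zero_iff.mpr h
    rw [ev] at this
    exact (norm_pos_iff.mp hYζpos) this
  have hsv : (supNorm (n • x + m - m') : ℝ) = ‖Y + ζ‖ := by rw [← norm_toReal, ev]
  -- the family's two-power error at the fine point
  have h1 := T.err4 L k (n • x + m - m') hv0
  rw [ev, hsv] at h1
  have h1' : (n : ℝ) ^ 2 * (T.B / ‖Y + ζ‖ ^ 4) ≤ 16 * T.B / (supNorm x : ℝ) ^ 4 := by
    have hp : ((n : ℝ) * supNorm x / 2) ^ 4 ≤ ‖Y + ζ‖ ^ 4 := by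
      refine pow_le_pow_left₀ (by positivity) ?_ 4
      rw [hYn] at hYζ; linarith
    have hB := T.nonneg_B
    calc (n : ℝ) ^ 2 * (T.B / ‖Y + ζ‖ ^ 4) = (n : ℝ) ^ 2 * T.B / ‖Y + ζ‖ ^ 4 := (mul_div_assoc _ _ _).symm
      _ ≤ (n : ℝ) ^ 2 * T.B / ((n : ℝ) * supNorm x / 2) ^ 4 := by gcongr
      _ = 16 * T.B / ((n : ℝ) ^ 2 * (supNorm x : ℝ) ^ 4) := by field_simp; ring
      _ ≤ 16 * T.B / (1 * (supNorm x : ℝ) ^ 4) := by gcongr; nlinarith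
      _ = 16 * T.B / (supNorm x : ℝ) ^ 4 := by rw [one_mul]
  -- the second-order Taylor remainder at the fine point
  have h3 := taylor2_invSq hY0 h2ζ
  have h3' : (n : ℝ) ^ 2 * (112 * ‖ζ‖ ^ 2 / ‖Y‖ ^ 4) ≤ 448 * (ρ : ℝ) ^ 2 / (supNorm x : ℝ) ^ 4 := by
    rw [hYn]
    have hζ0 : 0 ≤ ‖ζ‖ := norm_nonneg _
    calc (n : ℝ) ^ 2 * (112 * ‖ζ‖ ^ 2 / ((n : ℝ) * supNorm x) ^ 4)
        ≤ (n : ℝ) ^ 2 * (112 * (2 * ρ * n) ^ 2 / ((n : ℝ) * supNorm x) ^ 4) := by gcongr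
      _ = 448 * (ρ : ℝ) ^ 2 / (supNorm x : ℝ) ^ 4 := by field_simp; ring
  -- the scaling identities
  have hI1 : (n : ℝ) ^ 2 * invSq Y = invSq X := by
    rw [hY, invSq_smul]; field_simp
  have hI2 : (n : ℝ) ^ 2 * ∑ μ, ζ μ * d1InvSq μ Y = (∑ μ, ζ μ * d1InvSq μ X) / n := by
    rw [hY, Finset.mul_sum, Finset.sum_div]
    refine Finset.sum_congr rfl fun μ _ => ?_
    rw [d1InvSq_smul hn0]
    field_simp
  have e : (n : ℝ) ^ 2 * T.g L k (n • x + m - m') - c4 * invSq X - c4 * (∑ μ, ζ μ * d1InvSq μ X) / n =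
      (n : ℝ) ^ 2 * (T.g L k (n • x + m - m') - c4 * invSq (Y + ζ)) +
        c4 * ((n : ℝ) ^ 2 * (invSq (Y + ζ) - invSq Y - ∑ μ, ζ μ * d1InvSq μ Y)) := by
    linear_combination c4 * hI1 + c4 * hI2
  rw [e]
  calc |(n : ℝ) ^ 2 * (T.g L k (n • x + m - m') - c4 * invSq (Y + ζ)) +
          c4 * ((n : ℝ) ^ 2 * (invSq (Y + ζ) - invSq Y - ∑ μ, ζ μ * d1InvSq μ Y))|
      ≤ |(n : ℝ) ^ 2 * (T.g L k (n • x + m - m') - c4 * invSq (Y + ζ))| +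
          |c4 * ((n : ℝ) ^ 2 * (invSq (Y + ζ) - invSq Y - ∑ μ, ζ μ * d1InvSq μ Y))| := abs_add_le _ _
    _ = (n : ℝ) ^ 2 * |T.g L k (n • x + m - m') - c4 * invSq (Y + ζ)| +
          c4 * ((n : ℝ) ^ 2 * |invSq (Y + ζ) - invSq Y - ∑ μ, ζ μ * d1InvSq μ Y|) := by
        rw [abs_mul, abs_mul, abs_mul, abs_of_pos c4_pos, abs_of_nonneg (by positivity : (0 : ℝ) ≤ (n : ℝ) ^ 2)]
    _ ≤ (n : ℝ) ^ 2 * (T.B / ‖Y + ζ‖ ^ 4) + c4 * ((n : ℝ) ^ 2 * (112 * ‖ζ‖ ^ 2 / ‖Y‖ ^ 4)) := by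
        gcongr
        · exact c4_pos.le
    _ ≤ 16 * T.B / (supNorm x : ℝ) ^ 4 + c4 * (448 * (ρ : ℝ) ^ 2 / (supNorm x : ℝ) ^ 4) := by
        gcongr
        · exact c4_pos.le
    _ = (16 * T.B + 448 * c4 * (ρ : ℝ) ^ 2) / (supNorm x : ℝ) ^ 4 := by ring

/-- The normalised double average of a constant is the constant. [folklore] -/
theorem sum_sum_mul_const {S : Finset Pt} {ω : Pt → ℝ} (hω1 : ∑ m ∈ S, ω m = 1) (c : ℝ) :
    ∑ m ∈ S, ∑ m' ∈ S, ω m * ω m' * c = c := by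
  have e : ∀ m ∈ S, ∑ m' ∈ S, ω m * ω m' * c = ω m * c := by
    intro m _
    rw [Finset.sum_congr rfl fun m' _ => show ω m * ω m' * c = ω m * c * ω m' by ring, ← Finset.mul_sum, hω1, mul_one]
  rw [Finset.sum_congr rfl e, ← Finset.sum_mul, hω1, one_mul]

/-- **THE FIRST-ORDER CANCELLATION**: `Σ_{m,m′} ω(m)ω(m′)(φ(m) − φ(m′)) = 0` — no symmetry of `ω` needed. [folklore] -/
theorem sum_sum_mul_sub_eq_zero (S : Finset Pt) (ω φ : Pt → ℝ) :
    ∑ m ∈ S, ∑ m' ∈ S, ω m * ω m' * (φ m - φ m') = 0 := by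
  have h1 : ∑ m ∈ S, ∑ m' ∈ S, ω m * ω m' * φ m = (∑ m ∈ S, ω m * φ m) * ∑ m ∈ S, ω m := by
    rw [Finset.sum_mul]
    refine Finset.sum_congr rfl fun m _ => ?_
    rw [Finset.mul_sum]
    exact Finset.sum_congr rfl fun m' _ => by ring
  have h2 : ∑ m ∈ S, ∑ m' ∈ S, ω m * ω m' * φ m' = (∑ m ∈ S, ω m) * ∑ m ∈ S, ω m * φ m := by
    rw [Finset.sum_mul]
    refine Finset.sum_congr rfl fun m _ => ?_
    rw [Finset.mul_sum]
    exact Finset.sum_congr rfl fun m' _ => by ring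
  have e : ∀ m m', ω m * ω m' * (φ m - φ m') = ω m * ω m' * φ m - ω m * ω m' * φ m' := fun m m' => by ring
  simp_rw [e, Finset.sum_sub_distrib]
  rw [h1, h2]; ring

/-- **(F1), FAR FIELD**: for `1 ≤ n`, offsets `‖m‖∞ ≤ ρn` on `S`, normalised weights `Σω = 1`, `Σ|ω| ≤ Ω`, and
`‖x‖∞ ≥ 4ρ + 1`: `|Σ_{m,m′} ω(m)ω(m′)n²g(nx + m − m′) − c₄/|x|₂²| ≤ Ω²(16B + 448c₄ρ²)/‖x‖∞⁴`. [folklore] -/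
theorem block_far (L k : ℕ) {n ρ : ℕ} (hn : 1 ≤ n) {S : Finset Pt} {ω : Pt → ℝ}
    (hS : ∀ m ∈ S, supNorm m ≤ ρ * n) (hω1 : ∑ m ∈ S, ω m = 1) {Ω : ℝ} (hΩ : ∑ m ∈ S, |ω m| ≤ Ω)
    {x : Pt} (hx : 4 * ρ + 1 ≤ supNorm x) :
    |∑ m ∈ S, ∑ m' ∈ S, ω m * ω m' * ((n : ℝ) ^ 2 * T.g L k (n • x + m - m')) - c4 * invSq (toReal x)| ≤
      Ω ^ 2 * (16 * T.B + 448 * c4 * (ρ : ℝ) ^ 2) / (supNorm x : ℝ) ^ 4 := by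
  set K : ℝ := (16 * T.B + 448 * c4 * (ρ : ℝ) ^ 2) / (supNorm x : ℝ) ^ 4 with hK
  set φ : Pt → ℝ := fun m => c4 * (∑ μ, toReal m μ * d1InvSq μ (toReal x)) / n with hφ
  set e : Pt → Pt → ℝ := fun m m' =>
    (n : ℝ) ^ 2 * T.g L k (n • x + m - m') - c4 * invSq (toReal x) - (φ m - φ m') with he
  have hK0 : 0 ≤ K := by have := T.nonneg_B; have := c4_pos.le; positivity
  have hΩ0 : 0 ≤ Ω := (Finset.sum_nonneg fun _ _ => abs_nonneg _).trans hΩ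
  -- the linear term is a difference
  have hlin : ∀ m m', c4 * (∑ μ, toReal (m - m') μ * d1InvSq μ (toReal x)) / n = φ m - φ m' := by
    intro m m'
    simp only [hφ, toReal_sub, Pi.sub_apply, sub_mul, Finset.sum_sub_distrib]
    ring
  -- per-pair bound
  have hpair : ∀ m ∈ S, ∀ m' ∈ S, |e m m'| ≤ K := by
    intro m hm m' hm'
    have := pair_far T L k hn (hS m hm) (hS m' hm') hx
    rw [hlin] at this
    exact this
  -- the algebra of the double average
  have key : ∑ m ∈ S, ∑ m' ∈ S, ω m * ω m' * ((n : ℝ) ^ 2 * T.g L k (n • x + m - m')) - c4 * invSq (toReal x) =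
      ∑ m ∈ S, ∑ m' ∈ S, ω m * ω m' * e m m' := by
    have ex : ∀ m m', ω m * ω m' * e m m' = ω m * ω m' * ((n : ℝ) ^ 2 * T.g L k (n • x + m - m')) -
        ω m * ω m' * (c4 * invSq (toReal x)) - ω m * ω m' * (φ m - φ m') := by
      intro m m'; simp only [he]; ring
    simp_rw [ex, Finset.sum_sub_distrib]
    rw [sum_sum_mul_const hω1, sum_sum_mul_sub_eq_zero]
    ring
  rw [key]
  calc |∑ m ∈ S, ∑ m' ∈ S, ω m * ω m' * e m m'|
      ≤ ∑ m ∈ S, |∑ m' ∈ S, ω m * ω m' * e m m'| := Finset.abs_sum_le_sum_abs _ _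
    _ ≤ ∑ m ∈ S, ∑ m' ∈ S, |ω m| * |ω m'| * K := by
        refine Finset.sum_le_sum fun m hm => (Finset.abs_sum_le_sum_abs _ _).trans (Finset.sum_le_sum fun m' hm' => ?_)
        rw [abs_mul, abs_mul]
        exact mul_le_mul_of_nonneg_left (hpair m hm m' hm') (by positivity)
    _ = (∑ m ∈ S, |ω m|) * (∑ m ∈ S, |ω m|) * K := by
        rw [Finset.sum_mul_sum, Finset.sum_mul]
        refine Finset.sum_congr rfl fun m _ => ?_
        rw [Finset.sum_mul]
    _ ≤ Ω * Ω * K := by gcongr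
    _ = Ω ^ 2 * (16 * T.B + 448 * c4 * (ρ : ℝ) ^ 2) / (supNorm x : ℝ) ^ 4 := by rw [hK]; ring

end Far

/-! ## §3. (F2) NEAR FIELD: flat weights against the lattice sum `Σ_{‖u‖∞ ≤ R} |g(u)| ≤ U + 80(c₄+B)R²` -/

section Near

variable (T : TwoPower)

/-- **THE LATTICE SUM**: `Σ_{0 < ‖u‖∞ ≤ R} |g(u)| ≤ 80(c₄ + B)R²` (shell `r+1` has `≤ 80(r+1)³` points and `|g| ≤ (c₄+B)/(r+1)²`
there). [folklore] -/
theorem sum_annulus_abs_le (L k R : ℕ) : ∑ u ∈ annulus 4 0 R, |T.g L k u| ≤ 80 * (c4 + T.B) * (R : ℝ) ^ 2 := by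
  have hcB : 0 ≤ c4 + T.B := add_nonneg c4_pos.le T.nonneg_B
  have hf : ∀ r, ∀ z ∈ annulus 4 r (r + 1), |(fun u => |T.g L k u|) z| ≤ (c4 + T.B) / ((r : ℝ) + 1) ^ 2 := by
    intro r z hz
    obtain ⟨h1, h2⟩ := mem_annulus_iff.mp hz
    have hsz : supNorm z = r + 1 := le_antisymm h2 h1
    have hz0 : z ≠ 0 := by intro h; rw [supNorm_eq_zero_iff.mpr h] at hsz; omega
    have hb := T.baseLeg.abs_f_le L k hz0
    simp only [TwoPower.baseLeg_f, TwoPower.baseLeg_a] at hb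
    have hA : T.baseLeg.A = c4 := rfl
    have hB : T.baseLeg.B = T.B := rfl
    rw [hA, hB, hsz] at hb
    push_cast at hb
    simpa only [abs_abs] using hb
  have h := abs_sum_annulus_zero_le (M := R) hf
  rw [abs_of_nonneg (Finset.sum_nonneg fun _ _ => abs_nonneg _)] at h
  refine h.trans ?_
  calc ∑ r ∈ Finset.range R, ((annulus 4 r (r + 1)).card : ℝ) * ((c4 + T.B) / ((r : ℝ) + 1) ^ 2)
      ≤ ∑ r ∈ Finset.range R, 80 * ((r : ℝ) + 1) ^ 3 * ((c4 + T.B) / ((r : ℝ) + 1) ^ 2) :=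
        Finset.sum_le_sum fun r _ => mul_le_mul_of_nonneg_right (card_annulus_succ_four_le r) (by positivity)
    _ = ∑ r ∈ Finset.range R, 80 * (c4 + T.B) * ((r : ℝ) + 1) :=
        Finset.sum_congr rfl fun r _ => by field_simp
    _ ≤ ∑ _r ∈ Finset.range R, 80 * (c4 + T.B) * (R : ℝ) := by
        refine Finset.sum_le_sum fun r hr => ?_
        have : (r : ℝ) + 1 ≤ R := by exact_mod_cast Finset.mem_range.mp hr
        gcongr
    _ = 80 * (c4 + T.B) * (R : ℝ) ^ 2 := by rw [Finset.sum_const, Finset.card_range, nsmul_eq_mul]; ring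

/-- `Σ_{‖u‖∞ ≤ R} |g(u)| ≤ U + 80(c₄ + B)R²`. [folklore] -/
theorem sum_box_abs_le (L k R : ℕ) : ∑ u ∈ box 4 R, |T.g L k u| ≤ T.U + 80 * (c4 + T.B) * (R : ℝ) ^ 2 := by
  have hsub : box 4 0 ⊆ box 4 R := TransferUV.box_subset 4 (Nat.zero_le R)
  have hb0 : box 4 0 = ({0} : Finset Pt) := by
    ext w
    rw [mem_box_iff, Finset.mem_singleton, Nat.le_zero]
    exact supNorm_eq_zero_iff
  have e : box 4 R \ box 4 0 = annulus 4 0 R := rfl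
  rw [← Finset.sum_sdiff hsub, e, hb0, Finset.sum_singleton, add_comm]
  have h0 := T.bdd L k 0
  have h1 := sum_annulus_abs_le T L k R
  linarith

/-- Reindexing: `Σ_{m′∈S} |g(v − m′)| ≤ Σ_{‖u‖∞ ≤ R} |g(u)|` once `‖v − m′‖∞ ≤ R` on `S`. [folklore] -/
theorem sum_shift_abs_le (L k : ℕ) {S : Finset Pt} {v : Pt} {R : ℕ} (hR : ∀ m' ∈ S, supNorm (v - m') ≤ R) :
    ∑ m' ∈ S, |T.g L k (v - m')| ≤ ∑ u ∈ box 4 R, |T.g L k u| := by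
  have hinj : Set.InjOn (fun m' : Pt => v - m') S := fun a _ b _ h => sub_right_injective h
  rw [← Finset.sum_image (f := fun u => |T.g L k u|) hinj]
  refine Finset.sum_le_sum_of_subset_of_nonneg ?_ fun _ _ _ => abs_nonneg _
  intro u hu
  obtain ⟨m', hm', rfl⟩ := Finset.mem_image.mp hu
  exact mem_box_iff.mpr (hR m' hm')

/-- **(F2), NEAR FIELD**: for `1 ≤ n`, offsets `‖m‖∞ ≤ ρn` on `S`, `Σ|ω| ≤ Ω`, FLAT weights `|ω| ≤ Ω∞/n⁴` (`Ω∞ ≥ 0`), and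
`‖x‖∞ ≤ 4ρ`: `|Σ_{m,m′} ω(m)ω(m′)n²g(nx + m − m′)| ≤ ΩΩ∞(U + 2880(c₄ + B)ρ²)`, free of `n`. [folklore] -/
theorem block_near (L k : ℕ) {n ρ : ℕ} (hn : 1 ≤ n) {S : Finset Pt} {ω : Pt → ℝ}
    (hS : ∀ m ∈ S, supNorm m ≤ ρ * n) {Ω Ωi : ℝ} (hΩ : ∑ m ∈ S, |ω m| ≤ Ω) (hΩi : 0 ≤ Ωi)
    (hflat : ∀ m ∈ S, |ω m| ≤ Ωi / (n : ℝ) ^ 4) {x : Pt} (hx : supNorm x ≤ 4 * ρ) :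
    |∑ m ∈ S, ∑ m' ∈ S, ω m * ω m' * ((n : ℝ) ^ 2 * T.g L k (n • x + m - m'))| ≤
      Ω * Ωi * (T.U + 2880 * (c4 + T.B) * (ρ : ℝ) ^ 2) := by
  have hn' : (1 : ℝ) ≤ n := by exact_mod_cast hn
  have hρ0 : (0 : ℝ) ≤ ρ := Nat.cast_nonneg ρ
  have hΩ0 : 0 ≤ Ω := (Finset.sum_nonneg fun _ _ => abs_nonneg _).trans hΩ
  have hU := T.nonneg_U
  have hcB : 0 ≤ c4 + T.B := add_nonneg c4_pos.le T.nonneg_B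
  -- the inner sum, per `m ∈ S`
  have hR : ∀ m ∈ S, ∀ m' ∈ S, supNorm (n • x + m - m') ≤ 6 * ρ * n := by
    intro m hm m' hm'
    have h1 : (supNorm m : ℝ) ≤ ρ * n := by exact_mod_cast hS m hm
    have h2 : (supNorm m' : ℝ) ≤ ρ * n := by exact_mod_cast hS m' hm'
    have h3 : (supNorm x : ℝ) ≤ 4 * ρ := by exact_mod_cast hx
    have h4 := supNorm_sub_le_real (n • x + m) m'
    have h5 := supNorm_add_le_real (n • x) m
    have h6 := supNorm_nsmul_real n x
    have h7 : (n : ℝ) * supNorm x ≤ n * (4 * ρ) := mul_le_mul_of_nonneg_left h3 (by positivity)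
    have : (supNorm (n • x + m - m') : ℝ) ≤ 6 * ρ * n := by linarith
    exact_mod_cast this
  have hinner : ∀ m ∈ S, ∑ m' ∈ S, |T.g L k (n • x + m - m')| ≤
      T.U + 80 * (c4 + T.B) * ((6 * ρ * n : ℕ) : ℝ) ^ 2 :=
    fun m hm => (sum_shift_abs_le T L k (hR m hm)).trans (sum_box_abs_le T L k _)
  have hinner' : ∀ m ∈ S, ∑ m' ∈ S, |ω m'| * ((n : ℝ) ^ 2 * |T.g L k (n • x + m - m')|) ≤
      Ωi / (n : ℝ) ^ 2 * (T.U + 2880 * (c4 + T.B) * (ρ : ℝ) ^ 2 * (n : ℝ) ^ 2) := by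
    intro m hm
    calc ∑ m' ∈ S, |ω m'| * ((n : ℝ) ^ 2 * |T.g L k (n • x + m - m')|)
        ≤ ∑ m' ∈ S, Ωi / (n : ℝ) ^ 4 * ((n : ℝ) ^ 2 * |T.g L k (n • x + m - m')|) :=
          Finset.sum_le_sum fun m' hm' => mul_le_mul_of_nonneg_right (hflat m' hm') (by positivity)
      _ = Ωi / (n : ℝ) ^ 2 * ∑ m' ∈ S, |T.g L k (n • x + m - m')| := by
          rw [Finset.mul_sum]
          exact Finset.sum_congr rfl fun m' _ => by field_simp
      _ ≤ Ωi / (n : ℝ) ^ 2 * (T.U + 80 * (c4 + T.B) * ((6 * ρ * n : ℕ) : ℝ) ^ 2) :=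
          mul_le_mul_of_nonneg_left (hinner m hm) (by positivity)
      _ = Ωi / (n : ℝ) ^ 2 * (T.U + 2880 * (c4 + T.B) * (ρ : ℝ) ^ 2 * (n : ℝ) ^ 2) := by push_cast; ring
  calc |∑ m ∈ S, ∑ m' ∈ S, ω m * ω m' * ((n : ℝ) ^ 2 * T.g L k (n • x + m - m'))|
      ≤ ∑ m ∈ S, |∑ m' ∈ S, ω m * ω m' * ((n : ℝ) ^ 2 * T.g L k (n • x + m - m'))| := Finset.abs_sum_le_sum_abs _ _
    _ ≤ ∑ m ∈ S, |ω m| * ∑ m' ∈ S, |ω m'| * ((n : ℝ) ^ 2 * |T.g L k (n • x + m - m')|) := by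
        refine Finset.sum_le_sum fun m _ => (Finset.abs_sum_le_sum_abs _ _).trans (le_of_eq ?_)
        rw [Finset.mul_sum]
        refine Finset.sum_congr rfl fun m' _ => ?_
        rw [abs_mul, abs_mul, abs_mul, abs_of_nonneg (by positivity : (0 : ℝ) ≤ (n : ℝ) ^ 2)]; ring
    _ ≤ ∑ m ∈ S, |ω m| * (Ωi / (n : ℝ) ^ 2 * (T.U + 2880 * (c4 + T.B) * (ρ : ℝ) ^ 2 * (n : ℝ) ^ 2)) :=
        Finset.sum_le_sum fun m hm => mul_le_mul_of_nonneg_left (hinner' m hm) (abs_nonneg _)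
    _ = (∑ m ∈ S, |ω m|) * (Ωi / (n : ℝ) ^ 2 * (T.U + 2880 * (c4 + T.B) * (ρ : ℝ) ^ 2 * (n : ℝ) ^ 2)) := by
        rw [Finset.sum_mul]
    _ ≤ Ω * (Ωi / (n : ℝ) ^ 2 * (T.U + 2880 * (c4 + T.B) * (ρ : ℝ) ^ 2 * (n : ℝ) ^ 2)) :=
        mul_le_mul_of_nonneg_right hΩ (by positivity)
    _ = Ω * Ωi * (T.U / (n : ℝ) ^ 2 + 2880 * (c4 + T.B) * (ρ : ℝ) ^ 2) := by field_simp
    _ ≤ Ω * Ωi * (T.U + 2880 * (c4 + T.B) * (ρ : ℝ) ^ 2) := by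
        gcongr
        exact div_le_self hU (one_le_pow₀ hn')

end Near

/-! ## §4. BLOCK DATA and the block-averaged family as a `TwoPower` family; the wall -/

/-- **BLOCK DATA**, per `(L,k)`: a blocking scale `n ≥ 1`, a finite set `S` of fine offsets with `‖m‖∞ ≤ ρn`, and real
weights `ω` with `Σ_S ω = 1`, `Σ_S |ω| ≤ Ω`, `|ω| ≤ Ω∞/n⁴` (flat) — `ρ, Ω, Ω∞` FREE of `(L,k)`.  (The uniform average over
the cube `{0,…,n−1}⁴`: `ρ = 1`, `Ω = Ω∞ = 1`.)  A structure carrying data and proved (in)equalities; asserts nothing.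
[folklore] -/
structure BlockData where
  /-- blocking scale (fine points per unit length), per `(L,k)` -/
  n : ℕ → ℕ → ℕ
  /-- the block offsets, per `(L,k)` -/
  S : ℕ → ℕ → Finset Pt
  /-- the averaging weights, per `(L,k)` -/
  ω : ℕ → ℕ → Pt → ℝ
  /-- offset radius in units of `n` -/
  ρ : ℕ
  /-- bound on `Σ|ω|` -/
  Ω : ℝ
  /-- flatness constant: `|ω| ≤ Ω∞/n⁴` -/
  Ωinf : ℝ
  nonneg_Ωinf : 0 ≤ Ωinf
  one_le_n : ∀ L k, 1 ≤ n L k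
  supp : ∀ L k, ∀ m ∈ S L k, supNorm m ≤ ρ * n L k
  sum_one : ∀ L k, ∑ m ∈ S L k, ω L k m = 1
  abs_sum_le : ∀ L k, ∑ m ∈ S L k, |ω L k m| ≤ Ω
  flat : ∀ L k, ∀ m ∈ S L k, |ω L k m| ≤ Ωinf / (n L k : ℝ) ^ 4

namespace BlockData

/-- `0 ≤ Ω`. [folklore] -/
theorem nonneg_Ω (D : BlockData) : 0 ≤ D.Ω :=
  (Finset.sum_nonneg fun _ _ => abs_nonneg _).trans (D.abs_sum_le 0 0)

end BlockData

section Block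

variable (T : TwoPower) (D : BlockData)

/-- The block-averaged family `C L k x := Σ_{m,m′∈S} ω(m)ω(m′)·n²·g L k (n·x + m − m′)`. [folklore] -/
def blockAvg (L k : ℕ) (x : Pt) : ℝ :=
  ∑ m ∈ D.S L k, ∑ m' ∈ D.S L k, D.ω L k m * D.ω L k m' * ((D.n L k : ℝ) ^ 2 * T.g L k (D.n L k • x + m - m'))

/-- The far-field constant `Ω²(16B + 448c₄ρ²)`. [folklore] -/
def Kfar : ℝ := D.Ω ^ 2 * (16 * T.B + 448 * c4 * (D.ρ : ℝ) ^ 2)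

/-- The near-field constant `ΩΩ∞(U + 2880(c₄ + B)ρ²)`. [folklore] -/
def Unear : ℝ := D.Ω * D.Ωinf * (T.U + 2880 * (c4 + T.B) * (D.ρ : ℝ) ^ 2)

/-- `0 ≤ Kfar`. [folklore] -/
theorem Kfar_nonneg : 0 ≤ Kfar T D := by
  have := T.nonneg_B; have := c4_pos.le; unfold Kfar; positivity

/-- `0 ≤ Unear`. [folklore] -/
theorem Unear_nonneg : 0 ≤ Unear T D := by
  have := T.nonneg_B; have := T.nonneg_U; have := c4_pos.le; have := D.nonneg_Ω; have := D.nonneg_Ωinf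
  unfold Unear; positivity

/-- **THE BLOCK AVERAGE OF A TWO-POWER FAMILY IS A TWO-POWER FAMILY, constants FREE of the blocking scale**:
`B_C = Kfar + (Unear + c₄)(4ρ+1)⁴`, `U_C = Unear + c₄ + Kfar`. [folklore] -/
def block : TwoPower where
  g := blockAvg T D
  B := Kfar T D + (Unear T D + c4) * (4 * (D.ρ : ℝ) + 1) ^ 4
  U := Unear T D + c4 + Kfar T D
  nonneg_B := by
    have := Kfar_nonneg T D; have := Unear_nonneg T D; have := c4_pos.le; positivity
  nonneg_U := by
    have := Kfar_nonneg T D; have := Unear_nonneg T D; have := c4_pos.le; positivity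
  err4 L k x hx := by
    have hK := Kfar_nonneg T D; have hUn := Unear_nonneg T D; have hc := c4_pos.le
    have hs : (1 : ℝ) ≤ supNorm x := Leg.one_le_supNorm hx
    have hspos : (0 : ℝ) < supNorm x := by linarith
    rcases le_or_gt (4 * D.ρ + 1) (supNorm x) with hfar | hnear
    · have h := block_far T L k (D.one_le_n L k) (D.supp L k) (D.sum_one L k) (D.abs_sum_le L k) hfar
      refine h.trans ?_
      unfold Kfar
      gcongr
      have : 0 ≤ (Unear T D + c4) * (4 * (D.ρ : ℝ) + 1) ^ 4 := by positivity
      linarith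
    · have hx4 : supNorm x ≤ 4 * D.ρ := by omega
      have h := block_near T L k (D.one_le_n L k) (D.supp L k) (D.abs_sum_le L k) D.nonneg_Ωinf (D.flat L k) hx4
      have hl : |c4 * invSq (toReal x)| ≤ c4 := by
        refine (freeLeg.lead x hx).trans ?_
        exact div_le_self c4_pos.le (one_le_pow₀ hs)
      have ht : (supNorm x : ℝ) ≤ 4 * (D.ρ : ℝ) + 1 := by exact_mod_cast hnear.le
      have hpow : (supNorm x : ℝ) ^ 4 ≤ (4 * (D.ρ : ℝ) + 1) ^ 4 := pow_le_pow_left₀ hspos.le ht 4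
      calc |blockAvg T D L k x - c4 * invSq (toReal x)|
          ≤ |blockAvg T D L k x| + |c4 * invSq (toReal x)| := abs_sub _ _
        _ ≤ Unear T D + c4 := add_le_add h hl
        _ = (Unear T D + c4) * (supNorm x : ℝ) ^ 4 / (supNorm x : ℝ) ^ 4 := by field_simp
        _ ≤ (Kfar T D + (Unear T D + c4) * (4 * (D.ρ : ℝ) + 1) ^ 4) / (supNorm x : ℝ) ^ 4 := by
            gcongr
            nlinarith [mul_le_mul_of_nonneg_left hpow (add_nonneg hUn hc)]
  bdd L k x := by
    have hK := Kfar_nonneg T D; have hUn := Unear_nonneg T D; have hc := c4_pos.le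
    rcases le_or_gt (4 * D.ρ + 1) (supNorm x) with hfar | hnear
    · have hx : x ≠ 0 := by intro h; have := supNorm_eq_zero_iff.mpr h; omega
      have hs : (1 : ℝ) ≤ supNorm x := Leg.one_le_supNorm hx
      have h := block_far T L k (D.one_le_n L k) (D.supp L k) (D.sum_one L k) (D.abs_sum_le L k) hfar
      have hl : |c4 * invSq (toReal x)| ≤ c4 := by
        refine (freeLeg.lead x hx).trans ?_
        exact div_le_self c4_pos.le (one_le_pow₀ hs)
      have h' : D.Ω ^ 2 * (16 * T.B + 448 * c4 * (D.ρ : ℝ) ^ 2) / (supNorm x : ℝ) ^ 4 ≤ Kfar T D := by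
        unfold Kfar
        exact div_le_self (Kfar_nonneg T D) (one_le_pow₀ hs)
      calc |blockAvg T D L k x| = |(blockAvg T D L k x - c4 * invSq (toReal x)) + c4 * invSq (toReal x)| := by
            rw [sub_add_cancel]
        _ ≤ |blockAvg T D L k x - c4 * invSq (toReal x)| + |c4 * invSq (toReal x)| := abs_add_le _ _
        _ ≤ Kfar T D + c4 := add_le_add (h.trans h') hl
        _ ≤ Unear T D + c4 + Kfar T D := by linarith
    · have hx4 : supNorm x ≤ 4 * D.ρ := by omega
      have h := block_near T L k (D.one_le_n L k) (D.supp L k) (D.abs_sum_le L k) D.nonneg_Ωinf (D.flat L k) hx4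
      exact h.trans (by unfold Unear; linarith)

/-- unfolding. [folklore] -/
@[simp] theorem block_g (L k : ℕ) (x : Pt) : (block T D).g L k x = blockAvg T D L k x := rfl

/-- **THE WALL FROM BLOCK DATA**: the block-averaged family's undifferentiated and forward-gradient legs (`Leg`s with
`(L,k)`-free constants by `TwoPowerLegs`), any two-derivative leg `H` with continuum part `c₄∂_μ∂_ν|x|⁻²`, (W2) relative
to this table, (W3), window comparability ⟹ `stepBal N L − A ≤ β⁰(L,k)` for all `L ≥ 2`, `k`. [folklore] -/
theorem stepBal_le_of_block {μ ν : Fin 4} (hμν : μ ≠ ν) {N : ℝ} (hN : N ≠ 0) {H : Leg}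
    (hH : ∀ x, H.ℓ x = c4 * hessInvSq μ ν x) (hHa : H.a = 4)
    {β0 : ℕ → ℕ → ℝ} {K : ℕ → ℕ → Pt → ℝ} {A₁' D' cc : ℝ} {M : ℕ → ℕ} (hD : 0 ≤ D') (hc : 1 ≤ cc)
    (hM : ∀ L : ℕ, 2 ≤ L → 1 ≤ M L ∧ (L : ℝ) ≤ cc * M L) (hML : ∀ L : ℕ, 2 ≤ L → M L ≤ L)
    (hin : ∀ L : ℕ, 2 ≤ L → ∀ k : ℕ, ∀ w : Pt, w ≠ 0 →
      |K L k w - toReal w μ * toReal w ν *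
          lattBubble Finset.univ ![2 * N * N * 6, 2 * N * N * 10] ![(block T D).baseLeg, (block T D).fwdLeg μ]
            ![H, (block T D).fwdLeg ν] L k w| ≤ D' / ((supNorm w : ℝ) ^ 2 * (L : ℝ) ^ 2))
    (hout : ∀ L : ℕ, 2 ≤ L → ∀ k : ℕ, |β0 L k - ∑ w ∈ annulus 4 0 (M L), K L k w| ≤ A₁') :
    ∀ L : ℕ, 2 ≤ L → ∀ k : ℕ,
      B12Normalization.stepBal N L - WindowDecomposition.constA (|kappaBal N| * 24 + |kappaBal N| * 110592)
        (bubbleConst Finset.univ ![2 * N * N * 6, 2 * N * N * 10] ![(block T D).baseLeg, (block T D).fwdLeg μ]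
          ![H, (block T D).fwdLeg ν]) (A₁' + 80 * D') cc (kappaBal N * transverseValue) ≤ β0 L k :=
  stepBal_le_of_twoPower (block T D) hμν hN hH hHa hD hc hM hML hin hout

end Block


/-! ## §6. (F3) FOR BLOCK AVERAGES: sharp differences survive blocking (third-order expansion at ONE base point) -/

section Sharp

variable (T : TwoPower)

/-- `ip` is additive in the second slot. [folklore] -/
theorem ip_add_right (X ζ θ : E4) : ip X (ζ + θ) = ip X ζ + ip X θ := by
  simp only [ip, Pi.add_apply, mul_add, Finset.sum_add_distrib]

/-- `ip` is homogeneous in the second slot. [folklore] -/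
theorem ip_smul_right (X ζ : E4) (t : ℝ) : ip X (t • ζ) = t * ip X ζ := by
  simp only [ip, Pi.smul_apply, smul_eq_mul, Finset.mul_sum]
  exact Finset.sum_congr rfl fun _ _ => by ring

/-- `ip` is homogeneous in the first slot. [folklore] -/
theorem ip_smul_left (t : ℝ) (X ζ : E4) : ip (t • X) ζ = t * ip X ζ := by
  simp only [ip, Pi.smul_apply, smul_eq_mul, Finset.mul_sum]
  exact Finset.sum_congr rfl fun _ _ => by ring

/-- `ip` is subtractive in the second slot. [folklore] -/
theorem ip_sub_right (X ζ θ : E4) : ip X (ζ - θ) = ip X ζ - ip X θ := by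
  simp only [ip, Pi.sub_apply, mul_sub, Finset.sum_sub_distrib]

/-- `X · e_i = X_i`. [folklore] -/
theorem ip_toReal_unitVec (X : E4) (i : Fin 4) : ip X (toReal (unitVec i)) = X i := by
  rw [ip, ← sum_toReal_unitVec_mul i X]
  exact Finset.sum_congr rfl fun _ _ => by ring

/-- `|e_i|₂² = 1`. [folklore] -/
theorem r2_toReal_unitVec (i : Fin 4) : r2 (toReal (unitVec i)) = 1 := by
  rw [r2_eq_normSq, normSq]
  simp [unitVec, toReal, Pi.single_apply, Finset.sum_ite_eq']

/-- `‖e_i‖∞ = 1` in `ℝ⁴`. [folklore] -/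
theorem norm_toReal_unitVec (i : Fin 4) : ‖toReal (unitVec i)‖ = 1 := by
  rw [norm_toReal, supNorm_unitVec]; norm_num

/-- `∂_a∂_b|tX|⁻² = ∂_a∂_b|X|⁻²/t⁴` (`t ≠ 0`). [folklore] -/
theorem hessInvSq_smul {t : ℝ} (ht : t ≠ 0) (a b : Fin 4) (X : E4) :
    hessInvSq a b (t • X) = hessInvSq a b X / t ^ 4 := by
  simp only [hessInvSq, r2_smul, Pi.smul_apply, smul_eq_mul]
  by_cases hR : r2 X = 0
  · simp [hR]
  · have h6 : (t ^ 2 * r2 X) ^ 3 = t ^ 6 * r2 X ^ 3 := by ring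
    have h4 : (t ^ 2 * r2 X) ^ 2 = t ^ 4 * r2 X ^ 2 := by ring
    rw [h6, h4]
    split_ifs
    · rw [eq_div_iff (pow_ne_zero 4 ht)]
      field_simp
    · rw [eq_div_iff (pow_ne_zero 4 ht)]
      field_simp
      ring

/-- **TELESCOPING THE FINE FAMILY'S SHARP DIFFERENCES** along `n` unit steps: if `‖v + je_i‖∞ ≥ t > 0` for `j < n`
then `|g(v + ne_i) − g(v) − c₄(|v + ne_i|₂⁻² − |v|₂⁻²)| ≤ nB₃/t⁵`. [folklore] -/
theorem sharp_telescope {B₃ : ℝ} (hB : 0 ≤ B₃) (hT : SharpDiff T B₃) (L k : ℕ) (i : Fin 4) (v : Pt) {t : ℝ}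
    (ht : 0 < t) : ∀ n : ℕ, (∀ j : ℕ, j < n → t ≤ (supNorm (v + j • unitVec i) : ℝ)) →
      |T.g L k (v + n • unitVec i) - T.g L k v -
          c4 * (invSq (toReal (v + n • unitVec i)) - invSq (toReal v))| ≤ n * B₃ / t ^ 5 := by
  intro n
  induction n with
  | zero => intro _; simp
  | succ n ih =>
      intro hj
      have ih' := ih fun j hj' => hj j (Nat.lt_succ_of_lt hj')
      have htn := hj n (Nat.lt_succ_self n)
      have hu0 : v + n • unitVec i ≠ 0 := by
        intro h
        rw [h, (supNorm_eq_zero_iff).mpr rfl] at htn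
        simp at htn; linarith
      have hstep := hT L k (v + n • unitVec i) hu0 i
      have e1 : v + (n + 1) • unitVec i = v + n • unitVec i + unitVec i := by rw [succ_nsmul, add_assoc]
      rw [e1]
      have hb : B₃ / (supNorm (v + n • unitVec i) : ℝ) ^ 5 ≤ B₃ / t ^ 5 :=
        div_le_div_of_nonneg_left hB (pow_pos ht 5) (pow_le_pow_left₀ ht.le htn 5)
      have e2 : T.g L k (v + n • unitVec i + unitVec i) - T.g L k v -
          c4 * (invSq (toReal (v + n • unitVec i + unitVec i)) - invSq (toReal v)) =
          (T.g L k (v + n • unitVec i + unitVec i) - T.g L k (v + n • unitVec i) -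
            c4 * (invSq (toReal (v + n • unitVec i + unitVec i)) - invSq (toReal (v + n • unitVec i)))) +
          (T.g L k (v + n • unitVec i) - T.g L k v -
            c4 * (invSq (toReal (v + n • unitVec i)) - invSq (toReal v))) := by ring
      rw [e2]
      refine (abs_add_le _ _).trans ?_
      have : ((n + 1 : ℕ) : ℝ) * B₃ / t ^ 5 = B₃ / t ^ 5 + n * B₃ / t ^ 5 := by push_cast; ring
      rw [this]
      exact add_le_add (hstep.trans hb) ih'

/-- **ONE PAIR, SHARP, FAR FIELD** (`‖x‖∞ ≥ 4ρ + 2`): with `ζ = m − m′`, `X = x ∈ ℝ⁴`,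
`|n²(g(n(x+e_i)) + ζ) − g(nx + ζ)) − c₄(∂_i|X|⁻² + ∂_i∂_i|X|⁻²/2) − (c₄/n)(8(X·ζ)X_i/|X|₂⁶ − 2ζ_i/|X|₂⁴)|
 ≤ (32B₃ + 3712c₄((2ρ+1)³ + 8ρ³))/‖x‖∞⁵` — BOTH fine points expanded to third order at the SAME base point `nx`, so no
derivative of the Hessian is needed; the displayed `ζ`-linear term cancels after averaging. [folklore] -/
theorem pair_sharp {B₃ : ℝ} (hB : 0 ≤ B₃) (hT : SharpDiff T B₃) (L k : ℕ) {n ρ : ℕ} (hn : 1 ≤ n) {x m m' : Pt}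
    (hm : supNorm m ≤ ρ * n) (hm' : supNorm m' ≤ ρ * n) (i : Fin 4) (hx : 4 * ρ + 2 ≤ supNorm x) :
    |(n : ℝ) ^ 2 * (T.g L k (n • (x + unitVec i) + m - m') - T.g L k (n • x + m - m')) -
        c4 * (d1InvSq i (toReal x) + hessInvSq i i (toReal x) / 2) -
        c4 / n * (8 * ip (toReal x) (toReal (m - m')) * toReal x i / r2 (toReal x) ^ 3 -
          2 * toReal (m - m') i / r2 (toReal x) ^ 2)| ≤
      (32 * B₃ + 3712 * c4 * ((2 * (ρ : ℝ) + 1) ^ 3 + 8 * (ρ : ℝ) ^ 3)) / (supNorm x : ℝ) ^ 5 := by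
  set X : E4 := toReal x with hX
  set ζ : E4 := toReal (m - m') with hζ
  set E : E4 := toReal (unitVec i) with hE
  set Y : E4 := (n : ℝ) • X with hY
  set η : E4 := ζ + (n : ℝ) • E with hη
  have hn' : (1 : ℝ) ≤ n := by exact_mod_cast hn
  have hn0 : (n : ℝ) ≠ 0 := by positivity
  have hs : 4 * (ρ : ℝ) + 2 ≤ supNorm x := by exact_mod_cast hx
  have hρ0 : (0 : ℝ) ≤ ρ := Nat.cast_nonneg ρ
  have hs1 : (2 : ℝ) ≤ supNorm x := by linarith
  have hsX : ‖X‖ = supNorm x := norm_toReal x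
  have hYn : ‖Y‖ = n * supNorm x := by rw [hY, norm_natCast_smul, hsX]
  have hE1 : ‖E‖ = 1 := norm_toReal_unitVec i
  have hζle : ‖ζ‖ ≤ 2 * ρ * n := by
    have h1 : (supNorm m : ℝ) ≤ ρ * n := by exact_mod_cast hm
    have h2 : (supNorm m' : ℝ) ≤ ρ * n := by exact_mod_cast hm'
    rw [hζ, norm_toReal]
    have := supNorm_sub_le_real m m'
    linarith
  have hηle : ‖η‖ ≤ (2 * ρ + 1) * n := by
    rw [hη]
    refine (norm_add_le _ _).trans ?_
    rw [norm_natCast_smul, hE1, mul_one]; linarith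
  have h2ζ : 2 * ‖ζ‖ ≤ ‖Y‖ := by
    rw [hYn]; have : 4 * (ρ : ℝ) * n ≤ n * supNorm x := by nlinarith
    linarith
  have h2η : 2 * ‖η‖ ≤ ‖Y‖ := by
    rw [hYn]; have : (4 * (ρ : ℝ) + 2) * n ≤ n * supNorm x := by nlinarith
    nlinarith
  have hYpos : 0 < ‖Y‖ := by rw [hYn]; positivity
  have hY0 : Y ≠ 0 := norm_pos_iff.mp hYpos
  -- the two fine points
  have ev : toReal (n • x + m - m') = Y + ζ := by
    rw [toReal_sub, toReal_add, toReal_nsmul, hζ, toReal_sub, hY, hX, add_sub_assoc]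
  have hv' : n • (x + unitVec i) + m - m' = (n • x + m - m') + n • unitVec i := by
    rw [smul_add]; abel
  have ev' : toReal (n • x + m - m' + n • unitVec i) = Y + η := by
    rw [toReal_add, ev, toReal_nsmul, hη, hE, add_assoc]
  -- (a) the fine family's sharp differences, telescoped over `n` steps, all at distance `≥ ns/2`
  have ht : 0 < (n : ℝ) * supNorm x / 2 := by positivity
  have hfar : ∀ j : ℕ, j < n → (n : ℝ) * supNorm x / 2 ≤ (supNorm (n • x + m - m' + j • unitVec i) : ℝ) := by
    intro j hj
    have hj' : (j : ℝ) ≤ n := by exact_mod_cast hj.le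
    rw [← norm_toReal (n • x + m - m' + j • unitVec i), toReal_add, ev, toReal_nsmul, ← hE]
    have hw : ‖ζ + (j : ℝ) • E‖ ≤ 2 * ρ * n + n := by
      refine (norm_add_le _ _).trans ?_
      rw [norm_natCast_smul, hE1, mul_one]; linarith
    have := norm_sub_le (Y + (ζ + (j : ℝ) • E)) (ζ + (j : ℝ) • E)
    rw [add_sub_cancel_right, hYn] at this
    have : (4 * (ρ : ℝ) + 2) * n ≤ n * supNorm x := by nlinarith
    rw [add_assoc]
    linarith
  have hA := sharp_telescope T hB hT L k i (n • x + m - m') ht n hfar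
  rw [ev', ev] at hA
  have hA' : (n : ℝ) ^ 2 * ((n : ℝ) * B₃ / ((n : ℝ) * supNorm x / 2) ^ 5) ≤ 32 * B₃ / (supNorm x : ℝ) ^ 5 := by
    have hspos : (0 : ℝ) < supNorm x := by linarith
    calc (n : ℝ) ^ 2 * ((n : ℝ) * B₃ / ((n : ℝ) * supNorm x / 2) ^ 5)
        = 32 * B₃ / ((n : ℝ) ^ 2 * (supNorm x : ℝ) ^ 5) := by field_simp; ring
      _ ≤ 32 * B₃ / (1 * (supNorm x : ℝ) ^ 5) := by gcongr; nlinarith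
      _ = 32 * B₃ / (supNorm x : ℝ) ^ 5 := by rw [one_mul]
  -- (b) the continuum increments at the two fine points, third order at the base point `Y = nx`
  have hTa := taylor3_invSq hY0 h2η
  have hTb := taylor3_invSq hY0 h2ζ
  rw [sum_mul_d1InvSq, sum_sum_mul_hessInvSq] at hTa hTb
  -- scalar bookkeeping
  have hRY : r2 Y = (n : ℝ) ^ 2 * r2 X := by rw [hY, r2_smul]
  have hipη : ip Y η = n * (ip X ζ + n * X i) := by
    rw [hY, ip_smul_left, hη, ip_add_right, ip_smul_right, hE, ip_toReal_unitVec]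
  have hipζ : ip Y ζ = n * ip X ζ := by rw [hY, ip_smul_left]
  have hr2η : r2 η = r2 ζ + 2 * (n * ζ i) + (n : ℝ) ^ 2 := by
    rw [hη, r2_add, ip_smul_right, r2_smul, hE, ip_toReal_unitVec, r2_toReal_unitVec, mul_one]
  have hR0 : r2 X ≠ 0 := by
    have : (supNorm x : ℝ) ^ 2 ≤ r2 X := supNorm_sq_le_r2 x
    intro h; rw [h] at this; nlinarith
  have hd1 : d1InvSq i X = -2 * X i / r2 X ^ 2 := rfl
  have hH : hessInvSq i i X = 8 * X i * X i / r2 X ^ 3 - 2 / r2 X ^ 2 := by simp [hessInvSq]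
  have hTa' : (n : ℝ) ^ 2 * (3712 * ‖η‖ ^ 3 / ‖Y‖ ^ 5) ≤ 3712 * (2 * (ρ : ℝ) + 1) ^ 3 / (supNorm x : ℝ) ^ 5 := by
    rw [hYn]
    have hη0 : 0 ≤ ‖η‖ := norm_nonneg _
    calc (n : ℝ) ^ 2 * (3712 * ‖η‖ ^ 3 / ((n : ℝ) * supNorm x) ^ 5)
        ≤ (n : ℝ) ^ 2 * (3712 * ((2 * ρ + 1) * n) ^ 3 / ((n : ℝ) * supNorm x) ^ 5) := by gcongr
      _ = 3712 * (2 * (ρ : ℝ) + 1) ^ 3 / (supNorm x : ℝ) ^ 5 := by field_simp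
  have hTb' : (n : ℝ) ^ 2 * (3712 * ‖ζ‖ ^ 3 / ‖Y‖ ^ 5) ≤ 3712 * (8 * (ρ : ℝ) ^ 3) / (supNorm x : ℝ) ^ 5 := by
    rw [hYn]
    have hζ0 : 0 ≤ ‖ζ‖ := norm_nonneg _
    calc (n : ℝ) ^ 2 * (3712 * ‖ζ‖ ^ 3 / ((n : ℝ) * supNorm x) ^ 5)
        ≤ (n : ℝ) ^ 2 * (3712 * (2 * ρ * n) ^ 3 / ((n : ℝ) * supNorm x) ^ 5) := by gcongr
      _ = 3712 * (8 * (ρ : ℝ) ^ 3) / (supNorm x : ℝ) ^ 5 := by field_simp; ring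
  -- the algebraic identity
  have e : (n : ℝ) ^ 2 * (T.g L k (n • (x + unitVec i) + m - m') - T.g L k (n • x + m - m')) -
        c4 * (d1InvSq i X + hessInvSq i i X / 2) -
        c4 / n * (8 * ip X ζ * X i / r2 X ^ 3 - 2 * ζ i / r2 X ^ 2) =
      (n : ℝ) ^ 2 * (T.g L k (n • x + m - m' + n • unitVec i) - T.g L k (n • x + m - m') -
          c4 * (invSq (Y + η) - invSq (Y + ζ))) +
        c4 * ((n : ℝ) ^ 2 * (invSq (Y + η) - invSq Y - -2 * ip Y η / r2 Y ^ 2 -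
          1 / 2 * (8 * ip Y η ^ 2 / r2 Y ^ 3 - 2 * r2 η / r2 Y ^ 2))) -
        c4 * ((n : ℝ) ^ 2 * (invSq (Y + ζ) - invSq Y - -2 * ip Y ζ / r2 Y ^ 2 -
          1 / 2 * (8 * ip Y ζ ^ 2 / r2 Y ^ 3 - 2 * r2 ζ / r2 Y ^ 2))) := by
    rw [hv', hd1, hH, hRY, hipη, hipζ, hr2η]
    field_simp
    ring
  rw [e]
  calc |(n : ℝ) ^ 2 * (T.g L k (n • x + m - m' + n • unitVec i) - T.g L k (n • x + m - m') -
            c4 * (invSq (Y + η) - invSq (Y + ζ))) +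
          c4 * ((n : ℝ) ^ 2 * (invSq (Y + η) - invSq Y - -2 * ip Y η / r2 Y ^ 2 -
            1 / 2 * (8 * ip Y η ^ 2 / r2 Y ^ 3 - 2 * r2 η / r2 Y ^ 2))) -
          c4 * ((n : ℝ) ^ 2 * (invSq (Y + ζ) - invSq Y - -2 * ip Y ζ / r2 Y ^ 2 -
            1 / 2 * (8 * ip Y ζ ^ 2 / r2 Y ^ 3 - 2 * r2 ζ / r2 Y ^ 2)))|
      ≤ |(n : ℝ) ^ 2 * (T.g L k (n • x + m - m' + n • unitVec i) - T.g L k (n • x + m - m') -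
            c4 * (invSq (Y + η) - invSq (Y + ζ)))| +
          |c4 * ((n : ℝ) ^ 2 * (invSq (Y + η) - invSq Y - -2 * ip Y η / r2 Y ^ 2 -
            1 / 2 * (8 * ip Y η ^ 2 / r2 Y ^ 3 - 2 * r2 η / r2 Y ^ 2)))| +
          |c4 * ((n : ℝ) ^ 2 * (invSq (Y + ζ) - invSq Y - -2 * ip Y ζ / r2 Y ^ 2 -
            1 / 2 * (8 * ip Y ζ ^ 2 / r2 Y ^ 3 - 2 * r2 ζ / r2 Y ^ 2)))| := by
          refine (abs_sub _ _).trans ?_; gcongr; exact abs_add_le _ _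
    _ = (n : ℝ) ^ 2 * |T.g L k (n • x + m - m' + n • unitVec i) - T.g L k (n • x + m - m') -
            c4 * (invSq (Y + η) - invSq (Y + ζ))| +
          c4 * ((n : ℝ) ^ 2 * |invSq (Y + η) - invSq Y - -2 * ip Y η / r2 Y ^ 2 -
            1 / 2 * (8 * ip Y η ^ 2 / r2 Y ^ 3 - 2 * r2 η / r2 Y ^ 2)|) +
          c4 * ((n : ℝ) ^ 2 * |invSq (Y + ζ) - invSq Y - -2 * ip Y ζ / r2 Y ^ 2 -
            1 / 2 * (8 * ip Y ζ ^ 2 / r2 Y ^ 3 - 2 * r2 ζ / r2 Y ^ 2)|) := by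
        simp only [abs_mul, abs_of_pos c4_pos, abs_of_nonneg (by positivity : (0 : ℝ) ≤ (n : ℝ) ^ 2)]
    _ ≤ (n : ℝ) ^ 2 * ((n : ℝ) * B₃ / ((n : ℝ) * supNorm x / 2) ^ 5) +
          c4 * ((n : ℝ) ^ 2 * (3712 * ‖η‖ ^ 3 / ‖Y‖ ^ 5)) + c4 * ((n : ℝ) ^ 2 * (3712 * ‖ζ‖ ^ 3 / ‖Y‖ ^ 5)) := by
        gcongr
        · exact c4_pos.le
        · exact c4_pos.le
    _ ≤ 32 * B₃ / (supNorm x : ℝ) ^ 5 + c4 * (3712 * (2 * (ρ : ℝ) + 1) ^ 3 / (supNorm x : ℝ) ^ 5) +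
          c4 * (3712 * (8 * (ρ : ℝ) ^ 3) / (supNorm x : ℝ) ^ 5) := by
        gcongr
        · exact c4_pos.le
        · exact c4_pos.le
    _ = (32 * B₃ + 3712 * c4 * ((2 * (ρ : ℝ) + 1) ^ 3 + 8 * (ρ : ℝ) ^ 3)) / (supNorm x : ℝ) ^ 5 := by ring

/-- **(F3), FAR FIELD** (`‖x‖∞ ≥ 4ρ + 2`): the block-averaged family has sharp differences
`|C(x + e_i) − C(x) − c₄(|x + e_i|₂⁻² − |x|₂⁻²)| ≤ (Ω²(32B₃ + 3712c₄((2ρ+1)³ + 8ρ³)) + 3712c₄)/‖x‖∞⁵`, free of `n`. [folklore] -/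
theorem block_sharp_far {B₃ : ℝ} (hB : 0 ≤ B₃) (hT : SharpDiff T B₃) (L k : ℕ) {n ρ : ℕ} (hn : 1 ≤ n)
    {S : Finset Pt} {ω : Pt → ℝ} (hS : ∀ m ∈ S, supNorm m ≤ ρ * n) (hω1 : ∑ m ∈ S, ω m = 1) {Ω : ℝ}
    (hΩ : ∑ m ∈ S, |ω m| ≤ Ω) (i : Fin 4) {x : Pt} (hx : 4 * ρ + 2 ≤ supNorm x) :
    |(∑ m ∈ S, ∑ m' ∈ S, ω m * ω m' * ((n : ℝ) ^ 2 * T.g L k (n • (x + unitVec i) + m - m'))) -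
        (∑ m ∈ S, ∑ m' ∈ S, ω m * ω m' * ((n : ℝ) ^ 2 * T.g L k (n • x + m - m'))) -
        c4 * (invSq (toReal (x + unitVec i)) - invSq (toReal x))| ≤
      (Ω ^ 2 * (32 * B₃ + 3712 * c4 * ((2 * (ρ : ℝ) + 1) ^ 3 + 8 * (ρ : ℝ) ^ 3)) + 3712 * c4) /
        (supNorm x : ℝ) ^ 5 := by
  set X : E4 := toReal x with hX
  set E : E4 := toReal (unitVec i) with hE
  set K : ℝ := (32 * B₃ + 3712 * c4 * ((2 * (ρ : ℝ) + 1) ^ 3 + 8 * (ρ : ℝ) ^ 3)) / (supNorm x : ℝ) ^ 5 with hK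
  set ψ : Pt → ℝ := fun m =>
    c4 / n * (8 * ip X (toReal m) * X i / r2 X ^ 3 - 2 * toReal m i / r2 X ^ 2) with hψ
  set main : ℝ := c4 * (d1InvSq i X + hessInvSq i i X / 2) with hmain
  set e : Pt → Pt → ℝ := fun m m' =>
    (n : ℝ) ^ 2 * (T.g L k (n • (x + unitVec i) + m - m') - T.g L k (n • x + m - m')) - main - (ψ m - ψ m') with he
  have hs : 4 * (ρ : ℝ) + 2 ≤ supNorm x := by exact_mod_cast hx
  have hρ0 : (0 : ℝ) ≤ ρ := Nat.cast_nonneg ρ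
  have hs2 : (2 : ℝ) ≤ supNorm x := by linarith
  have hK0 : 0 ≤ K := by have := c4_pos.le; positivity
  have hΩ0 : 0 ≤ Ω := (Finset.sum_nonneg fun _ _ => abs_nonneg _).trans hΩ
  -- the `ζ`-linear term is a difference
  have hlin : ∀ m m', c4 / n * (8 * ip X (toReal (m - m')) * X i / r2 X ^ 3 - 2 * toReal (m - m') i / r2 X ^ 2) =
      ψ m - ψ m' := by
    intro m m'
    simp only [hψ, toReal_sub, ip_sub_right, Pi.sub_apply]
    ring
  have hpair : ∀ m ∈ S, ∀ m' ∈ S, |e m m'| ≤ K := by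
    intro m hm m' hm'
    have := pair_sharp T hB hT L k hn (hS m hm) (hS m' hm') i hx
    rw [hlin] at this
    exact this
  -- the continuum increment at unit scale, third order at `X`
  have hx0 : x ≠ 0 := by intro h; rw [h, (supNorm_eq_zero_iff).mpr rfl] at hx; omega
  have hsX : ‖X‖ = supNorm x := norm_toReal x
  have hX0 : X ≠ 0 := by rw [← norm_pos_iff, hsX]; linarith
  have h2E : 2 * ‖E‖ ≤ ‖X‖ := by rw [hE, norm_toReal_unitVec, hsX]; linarith
  have hT3 := taylor3_invSq hX0 h2E
  rw [hE, sum_toReal_unitVec_mul, sum_sum_toReal_unitVec_mul, norm_toReal_unitVec, one_pow, mul_one, hsX] at hT3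
  have evX : toReal (x + unitVec i) = X + toReal (unitVec i) := by rw [toReal_add]
  -- the algebra of the double average
  have key : (∑ m ∈ S, ∑ m' ∈ S, ω m * ω m' * ((n : ℝ) ^ 2 * T.g L k (n • (x + unitVec i) + m - m'))) -
        (∑ m ∈ S, ∑ m' ∈ S, ω m * ω m' * ((n : ℝ) ^ 2 * T.g L k (n • x + m - m'))) -
        c4 * (invSq (toReal (x + unitVec i)) - invSq X) =
      ∑ m ∈ S, ∑ m' ∈ S, ω m * ω m' * e m m' -
        c4 * (invSq (X + toReal (unitVec i)) - invSq X - d1InvSq i X - 1 / 2 * hessInvSq i i X) := by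
    have ex : ∀ m m', ω m * ω m' * e m m' =
        ω m * ω m' * ((n : ℝ) ^ 2 * T.g L k (n • (x + unitVec i) + m - m')) -
        ω m * ω m' * ((n : ℝ) ^ 2 * T.g L k (n • x + m - m')) - ω m * ω m' * main -
        ω m * ω m' * (ψ m - ψ m') := by
      intro m m'; simp only [he]; ring
    simp_rw [ex, Finset.sum_sub_distrib]
    rw [sum_sum_mul_const hω1, sum_sum_mul_sub_eq_zero, evX, hmain]
    ring
  rw [key]
  have hsum : |∑ m ∈ S, ∑ m' ∈ S, ω m * ω m' * e m m'| ≤ Ω ^ 2 * K := by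
    calc |∑ m ∈ S, ∑ m' ∈ S, ω m * ω m' * e m m'|
        ≤ ∑ m ∈ S, |∑ m' ∈ S, ω m * ω m' * e m m'| := Finset.abs_sum_le_sum_abs _ _
      _ ≤ ∑ m ∈ S, ∑ m' ∈ S, |ω m| * |ω m'| * K := by
          refine Finset.sum_le_sum fun m hm =>
            (Finset.abs_sum_le_sum_abs _ _).trans (Finset.sum_le_sum fun m' hm' => ?_)
          rw [abs_mul, abs_mul]
          exact mul_le_mul_of_nonneg_left (hpair m hm m' hm') (by positivity)
      _ = (∑ m ∈ S, |ω m|) * (∑ m ∈ S, |ω m|) * K := by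
          rw [Finset.sum_mul_sum, Finset.sum_mul]
          refine Finset.sum_congr rfl fun m _ => ?_
          rw [Finset.sum_mul]
      _ ≤ Ω * Ω * K := by gcongr
      _ = Ω ^ 2 * K := by ring
  calc |∑ m ∈ S, ∑ m' ∈ S, ω m * ω m' * e m m' -
          c4 * (invSq (X + toReal (unitVec i)) - invSq X - d1InvSq i X - 1 / 2 * hessInvSq i i X)|
      ≤ |∑ m ∈ S, ∑ m' ∈ S, ω m * ω m' * e m m'| +
          |c4 * (invSq (X + toReal (unitVec i)) - invSq X - d1InvSq i X - 1 / 2 * hessInvSq i i X)| :=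
        abs_sub _ _
    _ ≤ Ω ^ 2 * K + c4 * (3712 / (supNorm x : ℝ) ^ 5) := by
        refine add_le_add hsum ?_
        rw [abs_mul, abs_of_pos c4_pos]
        exact mul_le_mul_of_nonneg_left hT3 c4_pos.le
    _ = (Ω ^ 2 * (32 * B₃ + 3712 * c4 * ((2 * (ρ : ℝ) + 1) ^ 3 + 8 * (ρ : ℝ) ^ 3)) + 3712 * c4) /
          (supNorm x : ℝ) ^ 5 := by rw [hK]; ring

end Sharp

/-! ## §7. The block-averaged family has sharp differences; the wall from block data and (F3) of the fine family -/

section BlockSharp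

variable (T : TwoPower) (D : BlockData)

/-- The sharp-difference constant of the block family: `Ω²(32B₃ + 3712c₄((2ρ+1)³ + 8ρ³)) + 3712c₄ + (2U_C + 2c₄)(4ρ+2)⁵`.
[folklore] -/
def B3block (B₃ : ℝ) : ℝ :=
  D.Ω ^ 2 * (32 * B₃ + 3712 * c4 * ((2 * (D.ρ : ℝ) + 1) ^ 3 + 8 * (D.ρ : ℝ) ^ 3)) + 3712 * c4 +
    (2 * (block T D).U + 2 * c4) * (4 * (D.ρ : ℝ) + 2) ^ 5

/-- `0 ≤ B3block`. [folklore] -/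
theorem B3block_nonneg {B₃ : ℝ} (hB : 0 ≤ B₃) : 0 ≤ B3block T D B₃ := by
  have := c4_pos.le; have := (block T D).nonneg_U; unfold B3block; positivity

/-- `|c₄/|w|₂²| ≤ c₄` on `ℤ⁴` (value `0` at `w = 0`). [folklore] -/
theorem abs_c4_invSq_le (w : Pt) : |c4 * invSq (toReal w)| ≤ c4 := by
  by_cases hw : w = 0
  · subst hw
    have : invSq (toReal (0 : Pt)) = 0 := by
      rw [invSq, (toReal_eq_zero_iff).mpr rfl]; simp [r2_eq_normSq, normSq]
    rw [this, mul_zero, abs_zero]; exact c4_pos.le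
  · exact (freeLeg.lead w hw).trans (div_le_self c4_pos.le (one_le_pow₀ (Leg.one_le_supNorm hw)))

/-- **(F3) SURVIVES BLOCKING**: if the fine family has sharp differences with constant `B₃`, the block-averaged family
has sharp differences with the `(L,k)`-FREE constant `B3block`. [folklore] -/
theorem block_sharpDiff {B₃ : ℝ} (hB : 0 ≤ B₃) (hT : SharpDiff T B₃) : SharpDiff (block T D) (B3block T D B₃) := by
  intro L k x hx i
  have hc := c4_pos.le
  have hUC := (block T D).nonneg_U
  have hs : (1 : ℝ) ≤ supNorm x := Leg.one_le_supNorm hx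
  have hspos : (0 : ℝ) < supNorm x := by linarith
  have hρ0 : (0 : ℝ) ≤ D.ρ := Nat.cast_nonneg D.ρ
  simp only [block_g]
  rcases le_or_gt (4 * D.ρ + 2) (supNorm x) with hfar | hnear
  · have h := block_sharp_far T hB hT L k (D.one_le_n L k) (D.supp L k) (D.sum_one L k) (D.abs_sum_le L k) i hfar
    refine h.trans (div_le_div_of_nonneg_right ?_ (by positivity))
    unfold B3block
    have : 0 ≤ (2 * (block T D).U + 2 * c4) * (4 * (D.ρ : ℝ) + 2) ^ 5 := by positivity
    linarith
  · have ht : (supNorm x : ℝ) ≤ 4 * (D.ρ : ℝ) + 2 := by exact_mod_cast hnear.le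
    have hpow : (supNorm x : ℝ) ^ 5 ≤ (4 * (D.ρ : ℝ) + 2) ^ 5 := pow_le_pow_left₀ hspos.le ht 5
    have h1 := (block T D).bdd L k (x + unitVec i)
    have h2 := (block T D).bdd L k x
    simp only [block_g] at h1 h2
    have h3 := abs_c4_invSq_le (x + unitVec i)
    have h4 := abs_c4_invSq_le x
    have k1 := abs_sub (blockAvg T D L k (x + unitVec i) - blockAvg T D L k x)
      (c4 * (invSq (toReal (x + unitVec i)) - invSq (toReal x)))
    have k2 := abs_sub (blockAvg T D L k (x + unitVec i)) (blockAvg T D L k x)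
    have k3 : |c4 * (invSq (toReal (x + unitVec i)) - invSq (toReal x))| ≤
        |c4 * invSq (toReal (x + unitVec i))| + |c4 * invSq (toReal x)| := by
      rw [mul_sub]; exact abs_sub _ _
    have h0 : 0 ≤ D.Ω ^ 2 * (32 * B₃ + 3712 * c4 * ((2 * (D.ρ : ℝ) + 1) ^ 3 + 8 * (D.ρ : ℝ) ^ 3)) + 3712 * c4 := by
      positivity
    calc |blockAvg T D L k (x + unitVec i) - blockAvg T D L k x -
            c4 * (invSq (toReal (x + unitVec i)) - invSq (toReal x))|
        ≤ 2 * (block T D).U + 2 * c4 := by linarith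
      _ = (2 * (block T D).U + 2 * c4) * (supNorm x : ℝ) ^ 5 / (supNorm x : ℝ) ^ 5 := by field_simp
      _ ≤ B3block T D B₃ / (supNorm x : ℝ) ^ 5 := by
          refine div_le_div_of_nonneg_right ?_ (by positivity)
          unfold B3block
          nlinarith [mul_le_mul_of_nonneg_left hpow (by positivity : (0 : ℝ) ≤ 2 * (block T D).U + 2 * c4)]

/-- **THE WALL FROM BLOCK DATA AND (F3) OF THE FINE FAMILY ALONE**: all four legs of the table are now the block family's
own (`baseLeg`, `fwdLeg μ`, `mixedLeg`, `fwdLeg ν`), with `(L,k)`-free constants. [folklore] -/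
theorem stepBal_le_of_blockSharp {μ ν : Fin 4} (hμν : μ ≠ ν) {N : ℝ} (hN : N ≠ 0) {B₃ : ℝ} (hB : 0 ≤ B₃)
    (hT : SharpDiff T B₃)
    {β0 : ℕ → ℕ → ℝ} {K : ℕ → ℕ → Pt → ℝ} {A₁' D' cc : ℝ} {M : ℕ → ℕ} (hD : 0 ≤ D') (hc : 1 ≤ cc)
    (hM : ∀ L : ℕ, 2 ≤ L → 1 ≤ M L ∧ (L : ℝ) ≤ cc * M L) (hML : ∀ L : ℕ, 2 ≤ L → M L ≤ L)
    (hin : ∀ L : ℕ, 2 ≤ L → ∀ k : ℕ, ∀ w : Pt, w ≠ 0 →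
      |K L k w - toReal w μ * toReal w ν *
          lattBubble Finset.univ ![2 * N * N * 6, 2 * N * N * 10] ![(block T D).baseLeg, (block T D).fwdLeg μ]
            ![(block T D).mixedLeg hμν (B3block_nonneg T D hB) (block_sharpDiff T D hB hT), (block T D).fwdLeg ν]
            L k w| ≤ D' / ((supNorm w : ℝ) ^ 2 * (L : ℝ) ^ 2))
    (hout : ∀ L : ℕ, 2 ≤ L → ∀ k : ℕ, |β0 L k - ∑ w ∈ annulus 4 0 (M L), K L k w| ≤ A₁') :
    ∀ L : ℕ, 2 ≤ L → ∀ k : ℕ,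
      B12Normalization.stepBal N L - WindowDecomposition.constA (|kappaBal N| * 24 + |kappaBal N| * 110592)
        (bubbleConst Finset.univ ![2 * N * N * 6, 2 * N * N * 10] ![(block T D).baseLeg, (block T D).fwdLeg μ]
          ![(block T D).mixedLeg hμν (B3block_nonneg T D hB) (block_sharpDiff T D hB hT), (block T D).fwdLeg ν])
          (A₁' + 80 * D') cc (kappaBal N * transverseValue) ≤ β0 L k :=
  stepBal_le_of_twoPowerSharp (block T D) hμν hN _ _ hD hc hM hML hin hout

end BlockSharp

/-! ## §8. The block-averaged FREE covariance (every blocking scale): a `TwoPower` family, KERNEL -/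

/-- **THE BLOCK-AVERAGED MASSLESS FINE-LATTICE COVARIANCE** `Σ_{m,m′} ω(m)ω(m′)·n²·latticeGreen(n·x + m − m′)/2`, for ANY
block data (any `n(L,k)`, e.g. `L^k`), is a two-power family with `(L,k)`-FREE constants — hence (TwoPowerLegs) its
undifferentiated and gradient legs are `Leg`s.  The `U = 1` reading of (R7)'s `C_k` up to its local term; that
identification is the carrier's (an5 successor) and the dictionary's (an2 (iii)) business, NOT asserted. [folklore] -/
def freeBlock (D : BlockData) : TwoPower := block free D

/-- Its family, unfolded. [folklore] -/
theorem freeBlock_g (D : BlockData) (L k : ℕ) (x : Pt) :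
    (freeBlock D).g L k x = ∑ m ∈ D.S L k, ∑ m' ∈ D.S L k,
      D.ω L k m * D.ω L k m' * ((D.n L k : ℝ) ^ 2 * (latticeGreen (D.n L k • x + m - m') / 2)) := rfl


/-- The block-averaged free covariance has sharp differences, for every block data, with an `(L,k)`-FREE constant
(from lit1 v1.1's sharp gradient asymptotics via `TwoPowerLegs.free_sharp`). [folklore] -/
theorem freeBlock_sharp (D : BlockData) : ∃ B₃ : ℝ, 0 ≤ B₃ ∧ SharpDiff (freeBlock D) B₃ := by
  obtain ⟨B₃, hB, h⟩ := free_sharp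
  exact ⟨B3block free D B₃, B3block_nonneg free D hB, block_sharpDiff free D hB h⟩

/-- The block-averaged free covariance's mixed second-difference leg (`μ ≠ ν`), UNCONDITIONAL. [folklore] -/
def freeBlockMixedLeg (D : BlockData) {μ ν : Fin 4} (hμν : μ ≠ ν) : Leg :=
  (freeBlock D).mixedLeg hμν (Classical.choose_spec (freeBlock_sharp D)).1 (Classical.choose_spec (freeBlock_sharp D)).2

/-- Its continuum part. [folklore] -/
@[simp] theorem freeBlockMixedLeg_ℓ (D : BlockData) {μ ν : Fin 4} (hμν : μ ≠ ν) (x : E4) :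
    (freeBlockMixedLeg D hμν).ℓ x = c4 * hessInvSq μ ν x := rfl

/-- Its degree. [folklore] -/
@[simp] theorem freeBlockMixedLeg_a (D : BlockData) {μ ν : Fin 4} (hμν : μ ≠ ν) : (freeBlockMixedLeg D hμν).a = 4 := rfl

/-- **THE BLOCK-AVERAGED FREE RUNG, UNCONDITIONALLY, FOR EVERY BLOCKING SCALE**: with ALL FOUR legs the block-averaged
massless covariance's own (`n = n(L,k)` arbitrary, e.g. `L^k`; weights arbitrary normalised flat block weights), (W2)
relative to this table, (W3) and window comparability ⟹ `stepBal N L − A ≤ β⁰(L,k)` for all `L ≥ 2` and ALL `k`, with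
ONE `k`-free constant `A`.  No hypothesis on any Green-function asymptotics remains (lit1 v1.1 + LatticeGreenAsymptotics are
theorems); what remains EXTERNAL is only the identification of Bałaban's (W1) legs with these (carrier / dictionary) and
the (W2)/(W3) inputs `hin`/`hout` (rows an2 / an4 / ref).  [folklore] -/
theorem stepBal_le_of_freeBlockSharp (D : BlockData) {μ ν : Fin 4} (hμν : μ ≠ ν) {N : ℝ} (hN : N ≠ 0)
    {β0 : ℕ → ℕ → ℝ} {K : ℕ → ℕ → Pt → ℝ} {A₁' D' cc : ℝ} {M : ℕ → ℕ} (hD : 0 ≤ D') (hc : 1 ≤ cc)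
    (hM : ∀ L : ℕ, 2 ≤ L → 1 ≤ M L ∧ (L : ℝ) ≤ cc * M L) (hML : ∀ L : ℕ, 2 ≤ L → M L ≤ L)
    (hin : ∀ L : ℕ, 2 ≤ L → ∀ k : ℕ, ∀ w : Pt, w ≠ 0 →
      |K L k w - toReal w μ * toReal w ν *
          lattBubble Finset.univ ![2 * N * N * 6, 2 * N * N * 10] ![(freeBlock D).baseLeg, (freeBlock D).fwdLeg μ]
            ![freeBlockMixedLeg D hμν, (freeBlock D).fwdLeg ν] L k w| ≤ D' / ((supNorm w : ℝ) ^ 2 * (L : ℝ) ^ 2))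
    (hout : ∀ L : ℕ, 2 ≤ L → ∀ k : ℕ, |β0 L k - ∑ w ∈ annulus 4 0 (M L), K L k w| ≤ A₁') :
    ∀ L : ℕ, 2 ≤ L → ∀ k : ℕ,
      B12Normalization.stepBal N L - WindowDecomposition.constA (|kappaBal N| * 24 + |kappaBal N| * 110592)
        (bubbleConst Finset.univ ![2 * N * N * 6, 2 * N * N * 10] ![(freeBlock D).baseLeg, (freeBlock D).fwdLeg μ]
          ![freeBlockMixedLeg D hμν, (freeBlock D).fwdLeg ν]) (A₁' + 80 * D') cc (kappaBal N * transverseValue) ≤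
        β0 L k :=
  stepBal_le_of_twoPowerSharp (freeBlock D) hμν hN _ _ hD hc hM hML hin hout

end Literature.MathematicalPhysics.QuantumFieldTheory.Balaban1983to89.Beta.BlockLegs
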